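import Summits.CriticalPhenomena.PercolationContinuityZ3.Theorems.Transplant.SkelPhiFaceDataN
import HarnessLib

/-!
# N1 ({±1} node), (F) part 3b (hp-8 g33): the clauses of the face step `Skelφ.faceStepWN` (part 3) THAT NEED THE HISTORY — the region is a subbox
# of the law `Wt` in its window graph, lies in the support `Sx`, misses the root; the planar diameter of `E^far` under the skeleton map from the
# inverse reading; the rim excess — for an arbitrary lag-1 anchored scheme `S : KSchA V ℕ` with `hΓ : S.Γ = cellGeomSG₂ G (pr.ψ φ w₀) P w₀ Λ`;
# twin of `SkelPhiConcFaceData` §2 (hp-8 g30) over part 2 (`SkelPhiFaceStepN`)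

builds on p205010 (kernel theorem, internal audit signed; external expert review pending) — nothing in this file uses p205010; nothing here is a
claim about the open node `SamePDropOfSkeletonNeg`.
Lane `prim-bschramm`, seat `prim-hp-8` (gen 33); helper file (`--supports stmt-CriticalPhenomena-4575 --as helper`).
* `isSubbox_faceStepWN (hlipψ) (hws)`, `faceStepWN_Rg_subset_Sfin`, `root_mem_faceStepWN_Sfin`, `faceStepWN_root_eq`, `root_not_mem_faceStepWN_Rg`,
  `finSupp_faceStepWN`, **`hdiam_fine`** (planar diameter `m` of `E^far` under `φ`: rooms `(rdK 1 b' + rdK 0 b')(50 rmax + 1)D ≤ Mabs(m+1)`),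
  **`rim_excess_faceStepWN (hlipψ) (hws)`** (excess radius for a planar map `φ'` at planar diameter `m` of `E^far`).
[cite: KozmaNitzan2024, §4 p. 27 ((30)), p. 28 (Ω), p. 31, Lemma 12 (p. 24)] [cite: MartineauSevero2019, Cor. 2.2]
-/

noncomputable section

open MeasureTheory
open scoped Classical

namespace Summit.CriticalPhenomena.PercolationContinuityZ3.Theorems.Transplant

namespace Skelφ

open Literature.Probability.Percolation Literature.Probability.LatticeModels SimpleGraph KNCells KNLevels GadgetSystem Contour
open Literature.Probability.Percolation.KozmaNitzan
open Literature.Probability.Percolation.KozmaNitzan.Cells (oth oth_ne sgOf sgOf_sign stepVec_apply_fst stepVec_apply_oth eq_oth_of_ne oth_oth)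
open Literature.Barriers.CriticalPhenomena (graphBall graphBall_finite mem_graphBall_self graphBall_mono)
open BoxProdZ2 (ConcRadiiG mem_graphBall_succ_of_adj)
open Skel (winGraph WinStepData excess)

variable {V : Type} [DecidableEq V] {G : SimpleGraph V} [G.LocallyFinite]
variable {pr : FinePrm} {φ : V → Site 2} {P : PCells2} {w₀ : V} {Λ : ConcRadiiG} {b : Fin 2}

/-! ## §3 The clauses that need the history: subbox, support, root, planar diameter, rim excess -/

section History

variable {S : KSchA V ℕ} (hΓ : S.Γ = cellGeomSG₂ G (pr.ψ φ w₀) P w₀ Λ) (hΛ : WFS2 P Λ)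
variable {h : ProbeHistory V} {e : Site 2 × MDir} (hV : S.Valid₂ G h e) {a a' : ℕ} {du : MDir} (hdu : du ∈ S.onward G h (tgt e))
variable {j : ℕ} {o : Finset (Sym2 V)} (pc : ℤ) (aw Rlev N M L' : ℕ)

include hΓ hΛ hV hdu

/-- **The region of the face step is a subbox of `Wt` in its window graph** (from `Lip`, weak steps of the cell map). [cite: KozmaNitzan2024, §4 p. 31] -/
theorem isSubbox_faceStepWN (hlipψ : Lip G (pr.ψ φ w₀)) (hws : WeakSteps G (pr.ψ φ w₀)) :
    let Q := faceStepWN G pr φ P w₀ Λ b a' (tgt e) du j pc aw Rlev N M L' (S.Sx G h e a a' du)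
    KNLevels.IsSubbox (winGraph G Q.root Q.Rπ) (S.Wt G h e a a' du j o) S.p (stepRg G (pr.frame φ w₀ du.1 b) Q) :=
  isSubbox_Wt_sub₂ hΓ hΛ hV hdu hlipψ hws (stepRgN_subset_Win G pr φ P w₀ Λ b a' (tgt e) du j pc aw Rlev N M L' _)

omit hV hdu in
/-- `Rg ⊆ Sfin = Sx` (from `Lip`, weak steps). [folklore] -/
theorem faceStepWN_Rg_subset_Sfin (hlipψ : Lip G (pr.ψ φ w₀)) (hws : WeakSteps G (pr.ψ φ w₀)) :
    let Q := faceStepWN G pr φ P w₀ Λ b a' (tgt e) du j pc aw Rlev N M L' (S.Sx G h e a a' du)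
    stepRg G (pr.frame φ w₀ du.1 b) Q ⊆ Q.Sfin :=
  sub_subset_Sx₂ hΓ hΛ hlipψ hws (stepRgN_subset_Win G pr φ P w₀ Λ b a' (tgt e) du j pc aw Rlev N M L' _)

omit hΓ hΛ hdu in
/-- The root lies in the support. [folklore] -/
theorem root_mem_faceStepWN_Sfin :
    S.Γ.root ∈ (faceStepWN G pr φ P w₀ Λ b a' (tgt e) du j pc aw Rlev N M L' (S.Sx G h e a a' du)).Sfin := by
  show S.Γ.root ∈ S.Sx G h e a a' du
  unfold KSchA.Sx
  exact Finset.mem_union_left _ (Finset.mem_union_left _ hV.root_mem)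

omit hΛ hV hdu in
/-- The source of the face step is the scheme's root. [folklore] -/
theorem faceStepWN_root_eq : (faceStepWN G pr φ P w₀ Λ b a' (tgt e) du j pc aw Rlev N M L' (S.Sx G h e a a' du)).root = S.Γ.root := by
  rw [hΓ]; rfl

/-- The root lies off the region (from `Lip`, weak steps). [folklore] -/
theorem root_not_mem_faceStepWN_Rg (hlipψ : Lip G (pr.ψ φ w₀)) (hws : WeakSteps G (pr.ψ φ w₀)) :
    (faceStepWN G pr φ P w₀ Λ b a' (tgt e) du j pc aw Rlev N M L' (S.Sx G h e a a' du)).root ∉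
      stepRg G (pr.frame φ w₀ du.1 b) (faceStepWN G pr φ P w₀ Λ b a' (tgt e) du j pc aw Rlev N M L' (S.Sx G h e a a' du)) := by
  rw [faceStepWN_root_eq hΓ]
  exact root_not_mem_sub₂ hΓ hΛ hV hdu hlipψ hws (stepRgN_subset_Win G pr φ P w₀ Λ b a' (tgt e) du j pc aw Rlev N M L' _)

omit hΓ hΛ hV hdu in
/-- `Wt` is finitely supported on `Sfin = Sx`. [cite: KozmaNitzan2024, §4 p. 28 (Ω)] -/
theorem finSupp_faceStepWN :
    KNLevels.FinSupp (S.Wt G h e a a' du j o) (faceStepWN G pr φ P w₀ Λ b a' (tgt e) du j pc aw Rlev N M L' (S.Sx G h e a a' du)).Sfin :=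
  KSchA.finSupp_Wt

omit hΛ hV hdu in
/-- **The planar diameter of `E^far_{a'}(x, du)` under `φ`** from the inverse reading: cell points of `E^far` differ by `≤ 50 rmax` per coordinate
(`EfarN₂ ⊆ EfarN ⊆ cen x ± 25 (r₀, r₁)`), so `φ d − φ d' ∈ [−m, m]²` under the rooms `(rdK 1 b' + rdK 0 b')(50 rmax + 1)D ≤ Mabs(m+1)` (`b' = 0, 1`).
[folklore] -/
theorem hdiam_fine (hM : pr.A * TwoAxis.Para.modulus pr.n pr.h pr.vα pr.vβ ≠ 0) (hc₀ : 0 < pr.c₀) (hc₁ : 0 < pr.c₁) (hD : 0 < pr.D) {m : ℕ}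
    (hroom : ∀ b' : Fin 2, (pr.rdK 1 b' + pr.rdK 0 b') * ((50 * P.rmax : ℕ) + 1) * pr.D ≤ pr.Mabs * (m + 1)) (x : Site 2) :
    ∀ d ∈ S.Γ.Efar a' x du, ∀ d' ∈ S.Γ.Efar a' x du, φ d - φ d' ∈ box 2 m := by
  rw [hΓ]
  intro d hd d' hd'
  have hd1 : pr.ψ φ w₀ d ∈ P.EfarN x du := P.EfarN₂_subset_EfarN x du (φ_mem_of_mem_VWin hd)
  have hd2 : pr.ψ φ w₀ d' ∈ P.EfarN x du := P.EfarN₂_subset_EfarN x du (φ_mem_of_mem_VWin hd')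
  have hbox := (mem_box.1 (P.sub_mem_box_of_mem_EfarN hd1 hd2))
  have hk : ∀ k, |pr.ψ φ w₀ d k - pr.ψ φ w₀ d' k| ≤ ((50 * P.rmax : ℕ) : ℤ) := fun k => by
    have := hbox k; simp only [Pi.sub_apply] at this; exact abs_le.2 ⟨this.1, this.2⟩
  exact pr.sub_mem_box_of_read w₀ hc₀ hc₁ hD hM (hk 0) (hk 1) hroom

/-- **The rim excess of the face step**: `P_{Wt}(⋃_{t ∈ T ∖ M_{a'}(x+du)} root ↔ t) ≤ η` from an excess radius `R₁ ≤ rM_{a'}(x+du) − L'` at the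
running parameter for the planar map `φ'` (entrance depth `R₀ + 1`, `R₀ ≥ rQ_a(x), sup ρ_{a'}(x, du, ·)`; planar diameter `m` of `E^far` under `φ'`)
(from `Lip`, weak steps of the cell map). [cite: KozmaNitzan2024, §4 Lemma 12 (p. 24)] [cite: MartineauSevero2019, Cor. 2.2] -/
theorem rim_excess_faceStepWN [Countable V] (hlipψ : Lip G (pr.ψ φ w₀)) (hws : WeakSteps G (pr.ψ φ w₀)) {R₀ : ℕ}
    (hQ : Λ.rQ a (tgt e) ≤ R₀) (hρ : ∀ ℓ, Λ.ρ a' (tgt e) du ℓ ≤ R₀) {φ' : V → Site 2} {m : ℕ} {η : ℝ} {R₁ : ℕ}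
    (hR₁ : ∀ R', R₁ ≤ R' → ∀ (Rw : ℕ) (D' A' : Finset V), (∀ d ∈ D', d ∈ graphBall G w₀ Rw) →
      (∀ d ∈ D', ∀ d' ∈ D', φ' d - φ' d' ∈ box 2 m) → A' ⊆ D' → (∀ a ∈ A', a ∈ graphBall G w₀ (R₀ + 1)) →
        (bondPercolation G S.p).real (excess G w₀ R' D' A') ≤ η)
    (hR : R₁ ≤ Λ.rM a' (tgt e + stepVec du) - L')
    (hdiam : ∀ d ∈ S.Γ.Efar a' (tgt e) du, ∀ d' ∈ S.Γ.Efar a' (tgt e) du, φ' d - φ' d' ∈ box 2 m) :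
    (prodBernoulli (S.Wt G h e a a' du j o)).real
      (⋃ t ∈ (faceStepWN G pr φ P w₀ Λ b a' (tgt e) du j pc aw Rlev N M L' (S.Sx G h e a a' du)).T \
          S.Γ.M a' (tgt e + stepVec du), openConn S.Γ.root t) ≤ η := by
  have hroot : S.Γ.root = w₀ := by rw [hΓ]; rfl
  have hsub : (faceStepWN G pr φ P w₀ Λ b a' (tgt e) du j pc aw Rlev N M L' (S.Sx G h e a a' du)).T \ S.Γ.M a' (tgt e + stepVec du) ⊆
      (stepRg G (pr.frame φ w₀ du.1 b) (faceStepWN G pr φ P w₀ Λ b a' (tgt e) du j pc aw Rlev N M L' (S.Sx G h e a a' du))).filter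
        fun v => v ∉ graphBall G w₀ (Λ.rM a' (tgt e + stepVec du) - L') := by
    rw [hΓ]; exact faceStepWN_T_sdiff_subset G pr φ P w₀ Λ b a' (tgt e) du j pc aw Rlev N M L' _
  rw [hroot]
  refine le_trans (measureReal_mono (Set.iUnion₂_subset fun t ht => ?_) (measure_ne_top _ _))
    (rim_excess_sub₂ hΓ hΛ hV hdu (j := j) (o := o) hlipψ hws hQ hρ hR₁ hR hdiam
      (stepRgN_subset_Win G pr φ P w₀ Λ b a' (tgt e) du j pc aw Rlev N M L' (S.Sx G h e a a' du)))
  exact Set.subset_biUnion_of_mem (u := fun t => openConn w₀ t) (hsub ht)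

end History

end Skelφ

end Summit.CriticalPhenomena.PercolationContinuityZ3.Theorems.Transplant

end
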